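import Literature.AlgebraicGeometry.Motives.StandardConjecturesSl2Proofs
import HarnessLib

/-!
# The `𝔰𝔩₂`-triple of `X × X` for the product polarisation, by Künneth transport

For a Weil cohomology theory `W : WeilCohomology k K` with the hard Lefschetz property, `X` smooth
projective of dimension `n` with hyperplane class `η`, this file transports the `𝔰𝔩₂`-structure of
`H•(X)` (`StandardConjecturesSl2Proofs`: `L = (· ∪ η)`, Kleiman's `ᶜΛ`, weight `deg - n`) to
`H•(X × X)` along the Künneth isomorphism (axiom (B)), as in the proof of S. Kleiman, *Algebraic
cycles and the Weil conjectures* (1968), Thm. 2.9 (`A(X × X, L ⊗ 1 + 1 ⊗ L) ⇒ B(X)`), where the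
`𝔰𝔩₂`-triple of `X × X` for the product polarisation `L ⊗ 1 + 1 ⊗ L` is the tensor product of the
triple of `X` with itself:

* `prodClass η = η ⊠ 1 + 1 ⊠ η` (the product polarisation; rational algebraic,
  `prodClass_mem_ratAlgebraicClasses`, but not known to satisfy `IsHyperplaneClass`, so that the
  hypothesis `W.HasHardLefschetz` says nothing about it) and `lefschetzPow_prodClass_externalCup`:
  `L₁₂ (a ⊠ b) = L a ⊠ b + a ⊠ L b`;
* `clambdaKunneth` : the operator `ᶜΛ₁₂ = ᶜΛ ⊗ 1 + 1 ⊗ ᶜΛ` on `H•(X × X)` defined through the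
  Künneth isomorphism, `clambdaKunneth_externalCup`: `ᶜΛ₁₂ (a ⊠ b) = ᶜΛ a ⊠ b + a ⊠ ᶜΛ b`;
* `prod_lefschetz_clambda_sub` : the `𝔰𝔩₂` relation `[L₁₂, ᶜΛ₁₂] = (d - 2n) · id` on `Hᵈ(X × X)`,
  and the commutator identities `[L₁₂ˢ⁺¹, ᶜΛ₁₂] = (s + 1)(d - 2n + s) L₁₂ˢ`
  (`prod_lefschetzPow_clambda_sub`, `prod_clambda_lefschetzPow_of_le_one`);
* `prod_lefschetzPow_bijective` : **hard Lefschetz for the product polarisation**,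
  `L₁₂ʷ : Hᵈ(X × X) ⥲ H⁴ⁿ⁻ᵈ(X × X)` for `d + w = 2n` — injectivity by the elementary `𝔰𝔩₂`
  argument (`prod_lefschetzPow_injective`, strong induction on `d`, `char K = 0`), surjectivity by
  the Poincaré-duality dimension count on the smooth projective `X × X`
  (`IsSmoothProjective.tensor_holds`);
* `clambdaKunneth_eq_zero_of_primitive`, `clambdaKunneth_lefschetzPow_succ_of_primitive` :
  `L₁₂`-primitive classes are lowest-weight vectors for `ᶜΛ₁₂`, and the string formula
  `ᶜΛ₁₂ (L₁₂ʲ⁺¹ v) = (j + 1)(w - j) L₁₂ʲ v`;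
* `trace_cup_clambdaKunneth` : the **adjunction formula**
  `tr ((pr₁* x ∪ ᶜΛ₁₂ u) ∪ pr₂* y) = tr ((pr₁* ᶜΛ x ∪ u) ∪ pr₂* y) + tr ((pr₁* x ∪ u) ∪ pr₂* ᶜΛ y)`
  (in Kleiman's pairing form: if `u` induces `T` then `ᶜΛ₁₂ u` induces `ᶜΛ ∘ T + T ∘ ᶜΛ`), from the
  symmetry of `ᶜΛ` for the Poincaré pairing.

Everything is a theorem or an explicit definition, formal in the axioms of
`Literature.AlgebraicGeometry.Motives.WeilCohomology`; no named fact is introduced and nothing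
existing is restated. These are steps 3–4 of the proof of `D(X × X) ⇒ B(X)`
(`standardConjectureB_of_standardConjectureD_tensor`, Kleiman 1968 Thm. 2.9 with §3).

## References

* S. Kleiman, *Algebraic cycles and the Weil conjectures*, in: Dix exposés sur la cohomologie des
  schémas, North-Holland (1968), 359–386, §1.4 (1.4.6) and §2, Thm. 2.9.
  [Kleiman1968AlgebraicCycles]
* J. J. Ramón Marí, *On the Lefschetz standard conjecture*, arXiv:math/0703005 (2008), §1
  (`L_{X₁×X₂} = L_{X₁} ⊗ 1 + 1 ⊗ L_{X₂}`, Prop. 1.1).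
-/

universe u v

open CategoryTheory AlgebraicGeometry
open scoped DirectSum

noncomputable section

namespace Literature.AlgebraicGeometry.Motives

namespace WeilCohomology

variable {k : Type u} [Field k] {K : Type v} [Field K] [CharZero K] (W : WeilCohomology k K)
variable {n : ℕ} {X : SchemeOver k} {η : W.obj X 2}

/-! ## The product polarisation `η ⊠ 1 + 1 ⊠ η` on `X × X` -/

section Kunneth

open MonoidalCategory CartesianMonoidalCategory
open scoped TensorProduct

/-- The **product polarisation** `η₁₂ = pr₁* η ∪ pr₂* 1 + pr₁* 1 ∪ pr₂* η = pr₁* η + pr₂* η` on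
`X × X` (the class `L ⊗ 1 + 1 ⊗ L` of Kleiman 1968, Thm. 2.9; it is rational algebraic, but not
known to be a hyperplane class in the sense of `IsHyperplaneClass`). [cite: Kleiman1968AlgebraicCycles, Thm. 2.9] -/
def prodClass (η : W.obj X 2) : W.obj (X ⊗ X) 2 :=
  W.externalCup X X (rfl : 2 + 0 = 2) η (W.one X) + W.externalCup X X (rfl : 0 + 2 = 2) (W.one X) η

/-- `η¹ = η` (`1 ∪ η = η`). [folklore] -/
theorem pow_one_eq (hX : IsSmoothProjective n X) (η : W.obj X 2) : W.pow X η 1 = η :=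
  W.one_cup hX rfl η

/-- `L¹ x = x ∪ η`. [folklore] -/
theorem lefschetzPow_one_apply (hX : IsSmoothProjective n X) (η : W.obj X 2) {i j : ℕ}
    (h : i + 2 * 1 = j) (x : W.obj X i) : W.lefschetzPow X η 1 i j h x = W.cup h x η := by
  rw [PreWeilCohomology.lefschetzPow_apply, W.pow_one_eq hX η]

/-- **The Lefschetz operator of the product polarisation is `L ⊗ 1 + 1 ⊗ L`**:
`(a ⊠ b) ∪ η₁₂ = (a ∪ η) ⊠ b + a ⊠ (b ∪ η)` (graded commutativity on `X × X`, the signs being `+1`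
as `η` and `1` have even degree). [cite: Kleiman1968AlgebraicCycles, Thm. 2.9] -/
theorem lefschetzPow_prodClass_externalCup (hX : IsSmoothProjective n X) (η : W.obj X 2)
    {i j d i₂ j₂ e : ℕ} (h : i + j = d) (hi : i + 2 * 1 = i₂) (hj : j + 2 * 1 = j₂)
    (hde : d + 2 * 1 = e) (h₁ : i₂ + j = e) (h₂ : i + j₂ = e) (a : W.obj X i) (b : W.obj X j) :
    W.lefschetzPow (X ⊗ X) (W.prodClass η) 1 d e hde (W.externalCup X X h a b) =
      W.externalCup X X h₁ (W.lefschetzPow X η 1 i i₂ hi a) b +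
        W.externalCup X X h₂ a (W.lefschetzPow X η 1 j j₂ hj b) := by
  have hXX := isSmoothProjective_tensor hX hX
  rw [W.lefschetzPow_one_apply hXX, prodClass, map_add,
    W.cup_externalCup_externalCup hX hX h (show 2 + 0 = 2 * 1 from rfl) hde hi (Nat.add_zero j) h₁ a b η
      (W.one X),
    W.cup_externalCup_externalCup hX hX h (show 0 + 2 = 2 * 1 from rfl) hde (Nat.add_zero i) hj h₂ a b
      (W.one X) η,
    W.cup_one hX, W.cup_one hX, W.lefschetzPow_one_apply hX, W.lefschetzPow_one_apply hX,
    Int.negOnePow_even _ ⟨j, by push_cast; ring⟩, Units.val_one, one_smul,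
    Nat.cast_zero, mul_zero, Int.negOnePow_zero, Units.val_one, one_smul]

/-- The product polarisation is a rational algebraic class on `X × X` when `η` is
(`pullback_ratAlgebraicClasses_le`, `cup_mem_ratAlgebraicClasses`, `one_mem`). [folklore] -/
theorem prodClass_mem_ratAlgebraicClasses (hX : IsSmoothProjective n X) {η : W.obj X 2}
    (hη : η ∈ W.ratAlgebraicClasses X 1) (h1 : W.one X ∈ W.ratAlgebraicClasses X 0) :
    W.prodClass η ∈ W.ratAlgebraicClasses (X ⊗ X) 1 := by
  have hXX := isSmoothProjective_tensor hX hX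
  refine add_mem ?_ ?_
  · exact W.cup_mem_ratAlgebraicClasses hXX (show 1 + 0 = 1 from rfl) _ _
      (W.pullback_ratAlgebraicClasses_le hXX hX (fst X X) 1 ⟨η, hη, rfl⟩)
      (W.pullback_ratAlgebraicClasses_le hXX hX (snd X X) 0 ⟨W.one X, h1, rfl⟩)
  · exact W.cup_mem_ratAlgebraicClasses hXX (show 0 + 1 = 1 from rfl) _ _
      (W.pullback_ratAlgebraicClasses_le hXX hX (fst X X) 0 ⟨W.one X, h1, rfl⟩)
      (W.pullback_ratAlgebraicClasses_le hXX hX (snd X X) 1 ⟨η, hη, rfl⟩)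

/-! ## The lowering operator `ᶜΛ ⊗ 1 + 1 ⊗ ᶜΛ` of `X × X`, by Künneth transport -/

/-- The Künneth isomorphism `⨁_{i+j=d} Hⁱ(X) ⊗ Hʲ(X) ≃ Hᵈ(X × X)` (axiom (B)). [folklore] -/
def prodKunnethEquiv (hX : IsSmoothProjective n X) (d : ℕ) :
    (⨁ ij : ↥(Finset.antidiagonal d), W.obj X ij.1.1 ⊗[K] W.obj X ij.1.2) ≃ₗ[K]
      W.obj (X ⊗ X) d :=
  LinearEquiv.ofBijective (W.kunnethMap X X d) (W.bijective_kunnethMap hX hX d)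

/-- The inverse Künneth isomorphism on an external product. [folklore] -/
theorem prodKunnethEquiv_symm_externalCup (hX : IsSmoothProjective n X) {i j d : ℕ} (h : i + j = d)
    (a : W.obj X i) (b : W.obj X j) :
    (W.prodKunnethEquiv hX d).symm (W.externalCup X X h a b) =
      DirectSum.lof K _ (fun ij : ↥(Finset.antidiagonal d) ↦ W.obj X ij.1.1 ⊗[K] W.obj X ij.1.2)
        ⟨(i, j), Finset.mem_antidiagonal.mpr h⟩ (a ⊗ₜ b) := by
  rw [LinearEquiv.symm_apply_eq]
  exact (W.kunnethMap_of_tmul ⟨(i, j), Finset.mem_antidiagonal.mpr h⟩ a b).symm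

/-- The first summand `(ᶜΛ a) ⊠ b` of `ᶜΛ ⊗ 1 + 1 ⊗ ᶜΛ` on `Hⁱ(X) ⊗ Hʲ(X)`, as a bilinear map into
`Hᵐ'(X × X)`: the sum over the target degree `i'` of `ᶜΛ : Hⁱ → Hⁱ'` (only `i' = i - 2` with
`i' + j = m'` contributes). [folklore] -/
def clambdaExt₁ (hL : W.HasHardLefschetz) (hX : IsSmoothProjective n X)
    (hη : W.IsHyperplaneClass X η) (m' i j : ℕ) :
    W.obj X i →ₗ[K] W.obj X j →ₗ[K] W.obj (X ⊗ X) m' :=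
  ∑ i' ∈ Finset.range i,
    if h : i' + j = m' then (W.externalCup X X h).comp (W.clambdaOp hL hX hη i i') else 0

/-- The second summand `a ⊠ (ᶜΛ b)` of `ᶜΛ ⊗ 1 + 1 ⊗ ᶜΛ` on `Hⁱ(X) ⊗ Hʲ(X)`. [folklore] -/
def clambdaExt₂ (hL : W.HasHardLefschetz) (hX : IsSmoothProjective n X)
    (hη : W.IsHyperplaneClass X η) (m' i j : ℕ) :
    W.obj X i →ₗ[K] W.obj X j →ₗ[K] W.obj (X ⊗ X) m' :=
  ∑ j' ∈ Finset.range j,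
    if h : i + j' = m' then (W.externalCup X X h).compl₂ (W.clambdaOp hL hX hη j j') else 0

/-- **The lowering operator of `X × X`**, `ᶜΛ₁₂ = ᶜΛ ⊗ 1 + 1 ⊗ ᶜΛ` transported along the Künneth
isomorphism (Kleiman 1968, Thm. 2.9: the `𝔰𝔩₂`-triple of `X × X` for the product polarisation is
the tensor product of that of `X`): the graded operator on `H•(X × X)` whose component
`Hᵐ → Hᵐ'` sends `a ⊠ b` to `(ᶜΛ a) ⊠ b + a ⊠ (ᶜΛ b)` (`clambdaKunneth_externalCup`). [cite: Kleiman1968AlgebraicCycles, Thm. 2.9] -/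
def clambdaKunneth (hL : W.HasHardLefschetz) (hX : IsSmoothProjective n X)
    (hη : W.IsHyperplaneClass X η) : W.GradedOp (X ⊗ X) (X ⊗ X) := fun m m' ↦
  (DirectSum.toModule K _ _ fun ij : ↥(Finset.antidiagonal m) ↦
      TensorProduct.lift (W.clambdaExt₁ hL hX hη m' ij.1.1 ij.1.2 +
        W.clambdaExt₂ hL hX hη m' ij.1.1 ij.1.2)) ∘ₗ
    (W.prodKunnethEquiv hX m).symm.toLinearMap

/-- `ᶜΛ₁₂` on an external product, raw form. [folklore] -/
theorem clambdaKunneth_externalCup_eq (hL : W.HasHardLefschetz) (hX : IsSmoothProjective n X)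
    (hη : W.IsHyperplaneClass X η) {i j m m' : ℕ} (h : i + j = m) (a : W.obj X i) (b : W.obj X j) :
    W.clambdaKunneth hL hX hη m m' (W.externalCup X X h a b) =
      W.clambdaExt₁ hL hX hη m' i j a b + W.clambdaExt₂ hL hX hη m' i j a b := by
  simp only [clambdaKunneth, LinearMap.coe_comp, LinearEquiv.coe_coe, Function.comp_apply]
  rw [W.prodKunnethEquiv_symm_externalCup hX h, DirectSum.toModule_lof, TensorProduct.lift.tmul,
    LinearMap.add_apply, LinearMap.add_apply]

/-- The first summand evaluated: `(ᶜΛ a) ⊠ b` with `ᶜΛ a ∈ Hⁱ'`, `i' + 2 = i`. [folklore] -/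
theorem clambdaExt₁_apply (hL : W.HasHardLefschetz) (hX : IsSmoothProjective n X)
    (hη : W.IsHyperplaneClass X η) {m' i j i' : ℕ} (hi : i' + 2 = i) (h₁ : i' + j = m')
    (a : W.obj X i) (b : W.obj X j) :
    W.clambdaExt₁ hL hX hη m' i j a b = W.externalCup X X h₁ (W.clambdaOp hL hX hη i i' a) b := by
  rw [clambdaExt₁, LinearMap.sum_apply, LinearMap.sum_apply,
    Finset.sum_eq_single_of_mem i' (Finset.mem_range.mpr (by omega))]
  · rw [dif_pos h₁]
    rfl
  · intro i'' _ hne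
    have hne' : ¬ i'' + j = m' := by omega
    rw [dif_neg hne', LinearMap.zero_apply, LinearMap.zero_apply]

/-- The first summand vanishes on `Hⁱ(X) ⊗ Hʲ(X)` for `i ≤ 1` when `i + j = m' + 2`. [folklore] -/
theorem clambdaExt₁_eq_zero (hL : W.HasHardLefschetz) (hX : IsSmoothProjective n X)
    (hη : W.IsHyperplaneClass X η) {m' i j : ℕ} (hi : i ≤ 1) (hij : i + j = m' + 2)
    (a : W.obj X i) (b : W.obj X j) : W.clambdaExt₁ hL hX hη m' i j a b = 0 := by
  rw [clambdaExt₁, LinearMap.sum_apply, LinearMap.sum_apply]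
  refine Finset.sum_eq_zero fun i'' hi'' ↦ ?_
  have hne : ¬ i'' + j = m' := by
    have := Finset.mem_range.mp hi''
    omega
  rw [dif_neg hne, LinearMap.zero_apply, LinearMap.zero_apply]

/-- The second summand evaluated: `a ⊠ (ᶜΛ b)` with `ᶜΛ b ∈ Hʲ'`, `j' + 2 = j`. [folklore] -/
theorem clambdaExt₂_apply (hL : W.HasHardLefschetz) (hX : IsSmoothProjective n X)
    (hη : W.IsHyperplaneClass X η) {m' i j j' : ℕ} (hj : j' + 2 = j) (h₂ : i + j' = m')
    (a : W.obj X i) (b : W.obj X j) :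
    W.clambdaExt₂ hL hX hη m' i j a b = W.externalCup X X h₂ a (W.clambdaOp hL hX hη j j' b) := by
  rw [clambdaExt₂, LinearMap.sum_apply, LinearMap.sum_apply,
    Finset.sum_eq_single_of_mem j' (Finset.mem_range.mpr (by omega))]
  · rw [dif_pos h₂]
    rfl
  · intro j'' _ hne
    have hne' : ¬ i + j'' = m' := by omega
    rw [dif_neg hne', LinearMap.zero_apply, LinearMap.zero_apply]

/-- The second summand vanishes on `Hⁱ(X) ⊗ Hʲ(X)` for `j ≤ 1` when `i + j = m' + 2`. [folklore] -/
theorem clambdaExt₂_eq_zero (hL : W.HasHardLefschetz) (hX : IsSmoothProjective n X)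
    (hη : W.IsHyperplaneClass X η) {m' i j : ℕ} (hj : j ≤ 1) (hij : i + j = m' + 2)
    (a : W.obj X i) (b : W.obj X j) : W.clambdaExt₂ hL hX hη m' i j a b = 0 := by
  rw [clambdaExt₂, LinearMap.sum_apply, LinearMap.sum_apply]
  refine Finset.sum_eq_zero fun j'' hj'' ↦ ?_
  have hne : ¬ i + j'' = m' := by
    have := Finset.mem_range.mp hj''
    omega
  rw [dif_neg hne, LinearMap.zero_apply, LinearMap.zero_apply]

/-- **`ᶜΛ₁₂ (a ⊠ b) = (ᶜΛ a) ⊠ b + a ⊠ (ᶜΛ b)`** in degrees `i, j ≥ 2` (`i' + 2 = i`, `j' + 2 = j`,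
`m' + 2 = m = i + j`). [cite: Kleiman1968AlgebraicCycles, Thm. 2.9] -/
theorem clambdaKunneth_externalCup (hL : W.HasHardLefschetz) (hX : IsSmoothProjective n X)
    (hη : W.IsHyperplaneClass X η) {i j m m' i' j' : ℕ} (h : i + j = m)
    (hi : i' + 2 = i) (hj : j' + 2 = j) (h₁ : i' + j = m') (h₂ : i + j' = m') (a : W.obj X i)
    (b : W.obj X j) :
    W.clambdaKunneth hL hX hη m m' (W.externalCup X X h a b) =
      W.externalCup X X h₁ (W.clambdaOp hL hX hη i i' a) b +
        W.externalCup X X h₂ a (W.clambdaOp hL hX hη j j' b) := by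
  rw [W.clambdaKunneth_externalCup_eq hL hX hη h, W.clambdaExt₁_apply hL hX hη hi h₁,
    W.clambdaExt₂_apply hL hX hη hj h₂]

/-- `ᶜΛ₁₂ (a ⊠ b) = a ⊠ (ᶜΛ b)` when `a` has degree `≤ 1`. [folklore] -/
theorem clambdaKunneth_externalCup_of_left_le_one (hL : W.HasHardLefschetz)
    (hX : IsSmoothProjective n X) (hη : W.IsHyperplaneClass X η) {i j m m' j' : ℕ} (h : i + j = m)
    (hm : m' + 2 = m) (hi : i ≤ 1) (hj : j' + 2 = j) (h₂ : i + j' = m') (a : W.obj X i)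
    (b : W.obj X j) :
    W.clambdaKunneth hL hX hη m m' (W.externalCup X X h a b) =
      W.externalCup X X h₂ a (W.clambdaOp hL hX hη j j' b) := by
  rw [W.clambdaKunneth_externalCup_eq hL hX hη h, W.clambdaExt₁_eq_zero hL hX hη hi (by omega),
    W.clambdaExt₂_apply hL hX hη hj h₂, zero_add]

/-- `ᶜΛ₁₂ (a ⊠ b) = (ᶜΛ a) ⊠ b` when `b` has degree `≤ 1`. [folklore] -/
theorem clambdaKunneth_externalCup_of_right_le_one (hL : W.HasHardLefschetz)
    (hX : IsSmoothProjective n X) (hη : W.IsHyperplaneClass X η) {i j m m' i' : ℕ} (h : i + j = m)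
    (hm : m' + 2 = m) (hi : i' + 2 = i) (hj : j ≤ 1) (h₁ : i' + j = m') (a : W.obj X i)
    (b : W.obj X j) :
    W.clambdaKunneth hL hX hη m m' (W.externalCup X X h a b) =
      W.externalCup X X h₁ (W.clambdaOp hL hX hη i i' a) b := by
  rw [W.clambdaKunneth_externalCup_eq hL hX hη h, W.clambdaExt₁_apply hL hX hη hi h₁,
    W.clambdaExt₂_eq_zero hL hX hη hj (by omega), add_zero]

/-- `ᶜΛ₁₂ (a ⊠ b) = 0` when both `a`, `b` have degree `≤ 1`. [folklore] -/
theorem clambdaKunneth_externalCup_of_le_one (hL : W.HasHardLefschetz)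
    (hX : IsSmoothProjective n X) (hη : W.IsHyperplaneClass X η) {i j m m' : ℕ} (h : i + j = m)
    (hm : m' + 2 = m) (hi : i ≤ 1) (hj : j ≤ 1) (a : W.obj X i) (b : W.obj X j) :
    W.clambdaKunneth hL hX hη m m' (W.externalCup X X h a b) = 0 := by
  rw [W.clambdaKunneth_externalCup_eq hL hX hη h, W.clambdaExt₁_eq_zero hL hX hη hi (by omega),
    W.clambdaExt₂_eq_zero hL hX hη hj (by omega), add_zero]

/-- The components of `ᶜΛ₁₂` off degree `-2` vanish. [folklore] -/
theorem clambdaKunneth_eq_zero_of_ne (hL : W.HasHardLefschetz) (hX : IsSmoothProjective n X)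
    (hη : W.IsHyperplaneClass X η) {m m' : ℕ} (hm : m' + 2 ≠ m) :
    W.clambdaKunneth hL hX hη m m' = 0 := by
  refine LinearMap.ext fun u ↦ ?_
  rw [LinearMap.zero_apply]
  induction u using W.kunneth_induction hX hX with
  | zero => rw [map_zero]
  | add u v hu hv => rw [map_add, hu, hv, add_zero]
  | ext i j h a b =>
    rw [W.clambdaKunneth_externalCup_eq hL hX hη h, clambdaExt₁, clambdaExt₂, LinearMap.sum_apply,
      LinearMap.sum_apply, LinearMap.sum_apply, LinearMap.sum_apply,
      Finset.sum_eq_zero, Finset.sum_eq_zero, add_zero]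
    · intro j'' hj''
      by_cases hc : i + j'' = m'
      · rw [dif_pos hc, LinearMap.compl₂_apply, W.clambdaOp_eq_zero_of_ne hL hX hη (by omega),
          LinearMap.zero_apply, LinearMap.map_zero]
      · rw [dif_neg hc, LinearMap.zero_apply, LinearMap.zero_apply]
    · intro i'' hi''
      by_cases hc : i'' + j = m'
      · rw [dif_pos hc, LinearMap.comp_apply, W.clambdaOp_eq_zero_of_ne hL hX hη (by omega),
          LinearMap.zero_apply, LinearMap.map_zero₂]
      · rw [dif_neg hc, LinearMap.zero_apply, LinearMap.zero_apply]

/-! ## The `𝔰𝔩₂` relation on `X × X` -/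

/-- `(c • a) ⊠ b + a ⊠ (c' • b) = (c + c') • (a ⊠ b)`. [folklore] -/
theorem externalCup_smul_add_smul {i j d : ℕ} (h : i + j = d) (c c' : K) (a : W.obj X i)
    (b : W.obj X j) :
    W.externalCup X X h (c • a) b + W.externalCup X X h a (c' • b) =
      (c + c') • W.externalCup X X h a b := by
  rw [LinearMap.map_smul₂, LinearMap.map_smul, add_smul]

/-- The `𝔰𝔩₂` relation on `X`, rearranged: `L (ᶜΛ a) = ᶜΛ (L a) + (i - n) a` (`i ≥ 2`). [folklore] -/
theorem lefschetz_clambda_eq (hL : W.HasHardLefschetz) (hX : IsSmoothProjective n X)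
    (hη : W.IsHyperplaneClass X η) {i' i i₂ : ℕ} (hi : i' + 2 * 1 = i) (hi₂ : i + 2 * 1 = i₂)
    (a : W.obj X i) :
    W.lefschetzPow X η 1 i' i hi (W.clambdaOp hL hX hη i i' a) =
      W.clambdaOp hL hX hη i₂ i (W.lefschetzPow X η 1 i i₂ hi₂ a) + (((i : ℤ) - n : ℤ) : K) • a := by
  rw [← W.lefschetz_clambda_sub_clambda_lefschetz hL hX hη hi hi₂ a, add_sub_cancel]

/-- **The `𝔰𝔩₂` relation on `X × X`** for the product polarisation `η₁₂` and `ᶜΛ₁₂`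
(Kleiman 1968, Thm. 2.9: the triple of `X × X` is the tensor product of the triples of the factors):
on `Hᵈ(X × X)` with `d ≥ 2` (`c + 2 = d`, `d + 2 = e`), `L₁₂ (ᶜΛ₁₂ y) - ᶜΛ₁₂ (L₁₂ y) = (d - 2n) y`.
Checked on external products `a ⊠ b` (Künneth induction), where it reduces to the relations on the
factors (`lefschetz_clambda_sub_clambda_lefschetz`, `clambda_lefschetz_of_le_one`). [cite: Kleiman1968AlgebraicCycles, Thm. 2.9] -/
theorem prod_lefschetz_clambda_sub (hL : W.HasHardLefschetz) (hX : IsSmoothProjective n X)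
    (hη : W.IsHyperplaneClass X η) {c d e : ℕ} (hcd : c + 2 * 1 = d) (hde : d + 2 * 1 = e)
    (y : W.obj (X ⊗ X) d) :
    W.lefschetzPow (X ⊗ X) (W.prodClass η) 1 c d hcd (W.clambdaKunneth hL hX hη d c y) -
        W.clambdaKunneth hL hX hη e d (W.lefschetzPow (X ⊗ X) (W.prodClass η) 1 d e hde y) =
      (((d : ℤ) - 2 * n : ℤ) : K) • y := by
  induction y using W.kunneth_induction hX hX with
  | zero => simp
  | add y z hy hz => rw [map_add, map_add, map_add, map_add, smul_add, ← hy, ← hz]; abel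
  | ext i j h a b =>
    -- `L₁₂ (a ⊠ b) = L a ⊠ b + a ⊠ L b`
    rw [W.lefschetzPow_prodClass_externalCup hX η h rfl rfl hde (by omega) (by omega) a b, map_add]
    by_cases hi : 2 ≤ i <;> by_cases hj : 2 ≤ j
    · -- `i, j ≥ 2`
      obtain ⟨i', rfl⟩ : ∃ i', i = i' + 2 := ⟨i - 2, by omega⟩
      obtain ⟨j', rfl⟩ : ∃ j', j = j' + 2 := ⟨j - 2, by omega⟩
      rw [W.clambdaKunneth_externalCup hL hX hη h rfl rfl (by omega) (by omega) a b,
        map_add,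
        W.lefschetzPow_prodClass_externalCup hX η (by omega) rfl rfl hcd h (by omega),
        W.lefschetzPow_prodClass_externalCup hX η (by omega) rfl rfl hcd (by omega) h,
        W.clambdaKunneth_externalCup hL hX hη (by omega) rfl rfl h (by omega),
        W.clambdaKunneth_externalCup hL hX hη (by omega) rfl rfl (by omega) h,
        W.lefschetz_clambda_eq hL hX hη rfl rfl a, W.lefschetz_clambda_eq hL hX hη rfl rfl b,
        map_add, LinearMap.add_apply, LinearMap.map_smul₂, map_add, map_smul]
      have hc : (((d : ℤ) - 2 * n : ℤ) : K) =
          ((((i' + 2 : ℕ) : ℤ) - n : ℤ) : K) + ((((j' + 2 : ℕ) : ℤ) - n : ℤ) : K) := by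
        subst h
        push_cast
        ring
      rw [hc, add_smul]
      abel
    · -- `i ≥ 2`, `j ≤ 1`
      obtain ⟨i', rfl⟩ : ∃ i', i = i' + 2 := ⟨i - 2, by omega⟩
      have hj' : j ≤ 1 := by omega
      rw [W.clambdaKunneth_externalCup_of_right_le_one hL hX hη h (by omega) rfl hj' (by omega) a b,
        W.lefschetzPow_prodClass_externalCup hX η (by omega) rfl rfl hcd h (by omega),
        W.clambdaKunneth_externalCup_of_right_le_one hL hX hη (by omega) (by omega) rfl hj' h,
        W.clambdaKunneth_externalCup hL hX hη (by omega) rfl rfl (by omega) h,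
        W.lefschetz_clambda_eq hL hX hη rfl rfl a, W.clambda_lefschetz_of_le_one hL hX hη hj' rfl b,
        map_add, LinearMap.add_apply, LinearMap.map_smul₂, map_smul]
      have hc : (((d : ℤ) - 2 * n : ℤ) : K) =
          ((((i' + 2 : ℕ) : ℤ) - n : ℤ) : K) - (((n : ℤ) - j : ℤ) : K) := by
        subst h
        push_cast
        ring
      rw [hc, sub_smul]
      abel
    · -- `i ≤ 1`, `j ≥ 2`
      obtain ⟨j', rfl⟩ : ∃ j', j = j' + 2 := ⟨j - 2, by omega⟩
      have hi' : i ≤ 1 := by omega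
      rw [W.clambdaKunneth_externalCup_of_left_le_one hL hX hη h (by omega) hi' rfl (by omega) a b,
        W.lefschetzPow_prodClass_externalCup hX η (by omega) rfl rfl hcd (by omega) h,
        W.clambdaKunneth_externalCup hL hX hη (by omega) rfl rfl (by omega) (by omega),
        W.clambdaKunneth_externalCup_of_left_le_one hL hX hη (by omega) (by omega) hi' rfl h,
        W.lefschetz_clambda_eq hL hX hη rfl rfl b, W.clambda_lefschetz_of_le_one hL hX hη hi' rfl a,
        map_add, map_smul, LinearMap.map_smul₂]
      have hc : (((d : ℤ) - 2 * n : ℤ) : K) =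
          ((((j' + 2 : ℕ) : ℤ) - n : ℤ) : K) - (((n : ℤ) - i : ℤ) : K) := by
        subst h
        push_cast
        ring
      rw [hc, sub_smul]
      abel
    · -- `i, j ≤ 1`: then `d = 2`, `c = 0`, `i = j = 1`
      have hi' : i ≤ 1 := by omega
      have hj' : j ≤ 1 := by omega
      rw [W.clambdaKunneth_externalCup_of_le_one hL hX hη h (by omega) hi' hj' a b, map_zero,
        zero_sub,
        W.clambdaKunneth_externalCup_of_right_le_one hL hX hη (by omega) (by omega) rfl hj' h,
        W.clambdaKunneth_externalCup_of_left_le_one hL hX hη (by omega) (by omega) hi' rfl h,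
        W.clambda_lefschetz_of_le_one hL hX hη hi' rfl a,
        W.clambda_lefschetz_of_le_one hL hX hη hj' rfl b, LinearMap.map_smul₂, map_smul]
      have hc : (((d : ℤ) - 2 * n : ℤ) : K) =
          -(((n : ℤ) - i : ℤ) : K) - (((n : ℤ) - j : ℤ) : K) := by
        subst h
        push_cast
        ring
      rw [hc, sub_smul, neg_smul]
      abel

/-- The `𝔰𝔩₂` relation on `X × X` in the lowest degrees `d ≤ 1` (where `ᶜΛ₁₂ = 0` on `Hᵈ`):
`ᶜΛ₁₂ (L₁₂ y) = (2n - d) y`. [cite: Kleiman1968AlgebraicCycles, Thm. 2.9] -/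
theorem prod_clambda_lefschetz_of_le_one (hL : W.HasHardLefschetz) (hX : IsSmoothProjective n X)
    (hη : W.IsHyperplaneClass X η) {d e : ℕ} (hd : d ≤ 1) (hde : d + 2 * 1 = e)
    (y : W.obj (X ⊗ X) d) :
    W.clambdaKunneth hL hX hη e d (W.lefschetzPow (X ⊗ X) (W.prodClass η) 1 d e hde y) =
      ((2 * (n : ℤ) - d : ℤ) : K) • y := by
  induction y using W.kunneth_induction hX hX with
  | zero => simp
  | add y z hy hz => rw [map_add, map_add, smul_add, hy, hz]
  | ext i j h a b =>
    have hi' : i ≤ 1 := by omega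
    have hj' : j ≤ 1 := by omega
    rw [W.lefschetzPow_prodClass_externalCup hX η h rfl rfl hde (by omega) (by omega) a b, map_add,
      W.clambdaKunneth_externalCup_of_right_le_one hL hX hη (by omega) (by omega) rfl hj' h,
      W.clambdaKunneth_externalCup_of_left_le_one hL hX hη (by omega) (by omega) hi' rfl h,
      W.clambda_lefschetz_of_le_one hL hX hη hi' rfl a,
      W.clambda_lefschetz_of_le_one hL hX hη hj' rfl b, LinearMap.map_smul₂, map_smul, ← add_smul]
    congr 1
    subst h
    push_cast
    ring

/-! ## Commutators with powers of `L₁₂`, hard Lefschetz for the product polarisation -/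

/-- **`[L₁₂ˢ⁺¹, ᶜΛ₁₂] = (s + 1)(d - 2n + s) L₁₂ˢ` on `Hᵈ(X × X)`**, `d ≥ 2` (`c + 2 = d`; the standard
`𝔰𝔩₂` identity `[eˢ, f] = s eˢ⁻¹ (h + s - 1)`, by induction on `s` from `prod_lefschetz_clambda_sub`).
Degrees: `c + 2(s+1) = cs`, `d + 2(s+1) = ds`, `d + 2s = cs`. [folklore] -/
theorem prod_lefschetzPow_clambda_sub (hL : W.HasHardLefschetz) (hX : IsSmoothProjective n X)
    (hη : W.IsHyperplaneClass X η) {c d : ℕ} (hcd : c + 2 = d) (v : W.obj (X ⊗ X) d) (s : ℕ) :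
    ∀ {cs ds : ℕ} (hcs : c + 2 * (s + 1) = cs) (hds : d + 2 * (s + 1) = ds) (hd : d + 2 * s = cs),
      W.lefschetzPow (X ⊗ X) (W.prodClass η) (s + 1) c cs hcs (W.clambdaKunneth hL hX hη d c v) -
          W.clambdaKunneth hL hX hη ds cs (W.lefschetzPow (X ⊗ X) (W.prodClass η) (s + 1) d ds hds v) =
        (((s + 1) * ((d : ℤ) - 2 * n + s) : ℤ) : K) •
          W.lefschetzPow (X ⊗ X) (W.prodClass η) s d cs hd v := by
  have hXX := isSmoothProjective_tensor hX hX
  induction s with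
  | zero =>
    intro cs ds hcs hds hd
    obtain rfl : cs = d := by omega
    rw [W.lefschetzPow_zero_apply hXX, W.prod_lefschetz_clambda_sub hL hX hη hcs hds v]
    congr 1
    push_cast
    ring
  | succ s ih =>
    intro cs ds hcs hds hd
    -- intermediate degree `cs₀ = c + 2(s+1)`; note `d + 2(s+1) = cs`
    obtain ⟨cs₀, hcs₀⟩ : ∃ cs₀, c + 2 * (s + 1) = cs₀ := ⟨_, rfl⟩
    have h₁ : cs₀ + 2 * 1 = cs := by omega
    have h₂ : cs + 2 * 1 = ds := by omega
    have ih' := ih hcs₀ hd (show d + 2 * s = cs₀ by omega)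
    rw [sub_eq_iff_eq_add] at ih'
    rw [← W.lefschetzPow_lefschetzPow hXX _ (show s + 1 + 1 = s + 1 + 1 from rfl) hcs₀ h₁ hcs, ih',
      map_add, map_smul, W.lefschetzPow_lefschetzPow hXX _ rfl (show d + 2 * s = cs₀ by omega) h₁ hd,
      ← W.lefschetzPow_lefschetzPow hXX _ (show s + 1 + 1 = s + 1 + 1 from rfl) hd h₂ hds v,
      add_sub_assoc, W.prod_lefschetz_clambda_sub hL hX hη h₁ h₂, ← add_smul]
    subst hd
    congr 1
    push_cast
    ring

/-- The commutator identity in the lowest degrees `d ≤ 1` (no `ᶜΛ₁₂ v` term):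
`ᶜΛ₁₂ (L₁₂ˢ⁺¹ v) = -(s + 1)(d - 2n + s) L₁₂ˢ v`. [folklore] -/
theorem prod_clambda_lefschetzPow_of_le_one (hL : W.HasHardLefschetz) (hX : IsSmoothProjective n X)
    (hη : W.IsHyperplaneClass X η) {d : ℕ} (hd1 : d ≤ 1) (v : W.obj (X ⊗ X) d) (s : ℕ) :
    ∀ {cs ds : ℕ} (hds : d + 2 * (s + 1) = ds) (hd : d + 2 * s = cs),
      W.clambdaKunneth hL hX hη ds cs (W.lefschetzPow (X ⊗ X) (W.prodClass η) (s + 1) d ds hds v) =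
        ((-((s + 1) * ((d : ℤ) - 2 * n + s)) : ℤ) : K) •
          W.lefschetzPow (X ⊗ X) (W.prodClass η) s d cs hd v := by
  have hXX := isSmoothProjective_tensor hX hX
  induction s with
  | zero =>
    intro cs ds hds hd
    obtain rfl : cs = d := by omega
    rw [W.lefschetzPow_zero_apply hXX, W.prod_clambda_lefschetz_of_le_one hL hX hη hd1 hds v]
    congr 1
    push_cast
    ring
  | succ s ih =>
    intro cs ds hds hd
    obtain ⟨cs₀, hcs₀⟩ : ∃ cs₀, d + 2 * s = cs₀ := ⟨_, rfl⟩
    have h₁ : cs₀ + 2 * 1 = cs := by omega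
    have h₂ : cs + 2 * 1 = ds := by omega
    have key := W.prod_lefschetz_clambda_sub hL hX hη h₁ h₂
      (W.lefschetzPow (X ⊗ X) (W.prodClass η) (s + 1) d cs hd v)
    rw [ih hd hcs₀, map_smul, W.lefschetzPow_lefschetzPow hXX _ rfl hcs₀ h₁ hd] at key
    have key' := eq_sub_of_add_eq' (sub_eq_iff_eq_add.mp key).symm
    rw [← W.lefschetzPow_lefschetzPow hXX _ (show s + 1 + 1 = s + 1 + 1 from rfl) hd h₂ hds v, key',
      ← sub_smul]
    subst hd
    congr 1
    push_cast
    ring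

/-- **Hard Lefschetz for the product polarisation, injectivity**: for `d + w = 2n = dim (X × X)`,
`L₁₂ʷ : Hᵈ(X × X) → H⁴ⁿ⁻ᵈ(X × X)` is injective. Elementary `𝔰𝔩₂` argument by strong induction on
`d`: if `L₁₂ʷ v = 0` then `ᶜΛ₁₂ v ∈ Hᵈ⁻²` is killed by `L₁₂ʷ⁺²` (commutator identity), hence
vanishes by induction; then `v` is a lowest-weight vector of weight `-w` with `L₁₂ʷ v = 0`, and
`ᶜΛ₁₂ L₁₂ᵗ⁺¹ v = (t + 1)(w - t) L₁₂ᵗ v` forces `L₁₂ᵗ v = 0` for `t = w, w - 1, …, 0` (`char K = 0`).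
(Kleiman 1968, Thm. 2.9, uses hard Lefschetz for `L ⊗ 1 + 1 ⊗ L`, there a hyperplane class of the
Segre embedding; here it is derived from hard Lefschetz on the factors.) [cite: Kleiman1968AlgebraicCycles, Thm. 2.9] -/
theorem prod_lefschetzPow_injective (hL : W.HasHardLefschetz) (hX : IsSmoothProjective n X)
    (hη : W.IsHyperplaneClass X η) (d : ℕ) :
    ∀ {w e : ℕ} (_ : d + w = n + n) (he : d + 2 * w = e),
      Function.Injective (W.lefschetzPow (X ⊗ X) (W.prodClass η) w d e he) := by
  have hXX := isSmoothProjective_tensor hX hX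
  induction d using Nat.strong_induction_on with | _ d ih => ?_
  intro w e hw he
  subst he
  rw [injective_iff_map_eq_zero]
  intro v hv
  -- Step 1: `ᶜΛ₁₂ v = 0`
  have hF : ∀ {c : ℕ} (hcd : c + 2 = d), W.clambdaKunneth hL hX hη d c v = 0 := by
    intro c hcd
    have hinj := ih c (by omega) (w := w + 1 + 1) (e := c + 2 * (w + 1 + 1)) (by omega) rfl
    refine (injective_iff_map_eq_zero _).mp hinj _ ?_
    have key := W.prod_lefschetzPow_clambda_sub hL hX hη hcd v (w + 1)
      (cs := c + 2 * (w + 1 + 1)) (ds := d + 2 * (w + 1 + 1)) rfl rfl (by omega)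
    have h2 : W.lefschetzPow (X ⊗ X) (W.prodClass η) (w + 1 + 1) d (d + 2 * (w + 1 + 1)) rfl v = 0 := by
      rw [← W.lefschetzPow_lefschetzPow hXX _ (show w + (1 + 1) = w + 1 + 1 by omega) rfl
        (show d + 2 * w + 2 * (1 + 1) = d + 2 * (w + 1 + 1) by omega) rfl v, hv, map_zero]
    have h1 : W.lefschetzPow (X ⊗ X) (W.prodClass η) (w + 1) d (c + 2 * (w + 1 + 1)) (by omega) v =
        0 := by
      rw [← W.lefschetzPow_lefschetzPow hXX _ (show w + 1 = w + 1 from rfl) rfl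
        (show d + 2 * w + 2 * 1 = c + 2 * (w + 1 + 1) by omega) _ v, hv, map_zero]
    rwa [h2, map_zero, sub_zero, h1, smul_zero] at key
  -- Step 2: `L₁₂ᵗ v = 0` for `t + m = w`, by induction on `m`
  have hdesc : ∀ (m t e' : ℕ) (he' : d + 2 * t = e'), t + m = w →
      W.lefschetzPow (X ⊗ X) (W.prodClass η) t d e' he' v = 0 := by
    intro m
    induction m with
    | zero =>
      intro t e' he' htm
      obtain rfl : t = w := by omega
      subst he'
      exact hv
    | succ m ihm =>
      intro t e' he' htm
      have hup := ihm (t + 1) (d + 2 * (t + 1)) rfl (by omega)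
      have hcoef : (((t + 1) * ((d : ℤ) - 2 * n + t)) : ℤ) ≠ 0 := by
        apply mul_ne_zero <;> omega
      by_cases hd2 : 2 ≤ d
      · obtain ⟨c, hcd⟩ : ∃ c, c + 2 = d := ⟨d - 2, by omega⟩
        have key := W.prod_lefschetzPow_clambda_sub hL hX hη hcd v t (cs := e') (ds := d + 2 * (t + 1))
          (by omega) rfl he'
        rw [hF hcd, map_zero, hup, map_zero, sub_zero, eq_comm, smul_eq_zero] at key
        exact key.resolve_left (Int.cast_ne_zero.mpr hcoef)
      · have key := W.prod_clambda_lefschetzPow_of_le_one hL hX hη (by omega) v t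
          (ds := d + 2 * (t + 1)) rfl he'
        rw [hup, map_zero, eq_comm, smul_eq_zero] at key
        exact key.resolve_left (Int.cast_ne_zero.mpr (neg_ne_zero.mpr hcoef))
  have h0 := hdesc w 0 d (by omega) (by omega)
  rwa [W.lefschetzPow_zero_apply hXX] at h0

/-- **Hard Lefschetz for the product polarisation**: `L₁₂ʷ : Hᵈ(X × X) → H⁴ⁿ⁻ᵈ(X × X)` is bijective
for `d + w = 2n` (injectivity `prod_lefschetzPow_injective` and the Poincaré-duality dimension
count `bijective_lefschetzPow_iff_injective` on the smooth projective `X × X`). [cite: Kleiman1968AlgebraicCycles, Thm. 2.9] -/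
theorem prod_lefschetzPow_bijective (hL : W.HasHardLefschetz) (hX : IsSmoothProjective n X)
    (hη : W.IsHyperplaneClass X η) {d w e : ℕ} (hw : d + w = n + n) (he : d + 2 * w = e) :
    Function.Bijective (W.lefschetzPow (X ⊗ X) (W.prodClass η) w d e he) :=
  (W.bijective_lefschetzPow_iff_injective (isSmoothProjective_tensor hX hX) _ hw he).mpr
    (W.prod_lefschetzPow_injective hL hX hη d hw he)

/-- **Primitive classes are lowest-weight vectors**: if `v ∈ Hᵈ(X × X)` (`d ≥ 2`, `d + w = 2n`)
satisfies `L₁₂ʷ⁺¹ v = 0`, then `ᶜΛ₁₂ v = 0` (`ᶜΛ₁₂ v` is killed by `L₁₂ʷ⁺²`, which is injective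
on `Hᵈ⁻²`). [folklore] -/
theorem clambdaKunneth_eq_zero_of_primitive (hL : W.HasHardLefschetz) (hX : IsSmoothProjective n X)
    (hη : W.IsHyperplaneClass X η) {c d w e₁ : ℕ} (hcd : c + 2 = d) (hw : d + w = n + n)
    (he₁ : d + 2 * (w + 1) = e₁) {v : W.obj (X ⊗ X) d}
    (hv : W.lefschetzPow (X ⊗ X) (W.prodClass η) (w + 1) d e₁ he₁ v = 0) :
    W.clambdaKunneth hL hX hη d c v = 0 := by
  have hXX := isSmoothProjective_tensor hX hX
  have hinj := W.prod_lefschetzPow_injective hL hX hη c (w := w + 1 + 1) (e := e₁) (by omega)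
    (by omega)
  refine (injective_iff_map_eq_zero _).mp hinj _ ?_
  have key := W.prod_lefschetzPow_clambda_sub hL hX hη hcd v (w + 1) (cs := e₁)
    (ds := d + 2 * (w + 1 + 1)) (by omega) rfl he₁
  have h2 : W.lefschetzPow (X ⊗ X) (W.prodClass η) (w + 1 + 1) d (d + 2 * (w + 1 + 1)) rfl v = 0 := by
    rw [← W.lefschetzPow_lefschetzPow hXX _ (show w + 1 + 1 = w + 1 + 1 from rfl) he₁
      (show e₁ + 2 * 1 = d + 2 * (w + 1 + 1) by omega) rfl v, hv, map_zero]
  rwa [h2, map_zero, sub_zero, hv, smul_zero] at key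

/-- **The string formula**: for `v ∈ Hᵈ(X × X)` with `d + w = 2n` and `L₁₂ʷ⁺¹ v = 0` (a lowest-weight
vector of weight `-w`), `ᶜΛ₁₂ (L₁₂ʲ⁺¹ v) = (j + 1)(w - j) L₁₂ʲ v` (the standard `𝔰𝔩₂` computation;
Mathlib's `IsSl2Triple.HasPrimitiveVectorWith.lie_e_pow_succ_toEnd_f` with the roles of `e`, `f`
exchanged). Degrees: `d + 2(j+1) = ds`, `d + 2j = cs`. [folklore] -/
theorem clambdaKunneth_lefschetzPow_succ_of_primitive (hL : W.HasHardLefschetz)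
    (hX : IsSmoothProjective n X) (hη : W.IsHyperplaneClass X η) {d w e₁ : ℕ} (hw : d + w = n + n)
    (he₁ : d + 2 * (w + 1) = e₁) {v : W.obj (X ⊗ X) d}
    (hv : W.lefschetzPow (X ⊗ X) (W.prodClass η) (w + 1) d e₁ he₁ v = 0) (j : ℕ) {cs ds : ℕ}
    (hds : d + 2 * (j + 1) = ds) (hd : d + 2 * j = cs) :
    W.clambdaKunneth hL hX hη ds cs (W.lefschetzPow (X ⊗ X) (W.prodClass η) (j + 1) d ds hds v) =
      (((j + 1) * ((w : ℤ) - j) : ℤ) : K) • W.lefschetzPow (X ⊗ X) (W.prodClass η) j d cs hd v := by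
  have hw' : (d : ℤ) + w = n + n := by exact_mod_cast hw
  by_cases hd2 : 2 ≤ d
  · obtain ⟨c, hcd⟩ : ∃ c, c + 2 = d := ⟨d - 2, by omega⟩
    have hF := W.clambdaKunneth_eq_zero_of_primitive hL hX hη hcd hw he₁ hv
    have key := W.prod_lefschetzPow_clambda_sub hL hX hη hcd v j (cs := cs) (ds := ds) (by omega)
      hds hd
    rw [hF, map_zero, zero_sub, neg_eq_iff_eq_neg, ← neg_smul] at key
    rw [key]
    congr 1
    rw [← Int.cast_neg]
    congr 1
    linear_combination (-(j : ℤ) - 1) * hw'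
  · rw [W.prod_clambda_lefschetzPow_of_le_one hL hX hη (by omega) v j hds hd]
    congr 2
    linear_combination (-(j : ℤ) - 1) * hw'

/-! ## The adjunction formula for `ᶜΛ₁₂` in Kleiman's pairing form -/

/-- The pairing `tr_{X×X} ((pr₁* x ∪ ·) ∪ pr₂* y)` against the first summand `(ᶜΛ α) ⊠ β` of
`ᶜΛ₁₂ (α ⊠ β)` equals the pairing of `α ⊠ β` with `x` replaced by `ᶜΛ x` (symmetry of `ᶜΛ`,
`cupPairing_clambdaOp_left`; the degenerate cases vanish on both sides). [folklore] -/
theorem trace_cup_clambdaExt₁ (hL : W.HasHardLefschetz) (hX : IsSmoothProjective n X)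
    (hη : W.IsHyperplaneClass X η) {s t m m' a a₂ b' : ℕ} (hst : s + t = m) (hm : m' + 2 = m)
    (ha : a₂ + 2 = a) (h : a + m' + b' = 2 * (n + n)) (h₁ : a₂ + m + b' = 2 * (n + n))
    (x : W.obj X a) (α : W.obj X s) (β : W.obj X t) (y : W.obj X b') :
    W.trace (X ⊗ X) (n + n) (W.cup h (W.cup rfl (W.pullback (fst X X) a x)
        (W.clambdaExt₁ hL hX hη m' s t α β)) (W.pullback (snd X X) b' y)) =
      W.trace (X ⊗ X) (n + n) (W.cup h₁ (W.cup rfl (W.pullback (fst X X) a₂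
        (W.clambdaOp hL hX hη a a₂ x)) (W.externalCup X X hst α β)) (W.pullback (snd X X) b' y)) := by
  by_cases hs : 2 ≤ s
  · obtain ⟨s', rfl⟩ : ∃ s', s = s' + 2 := ⟨s - 2, by omega⟩
    rw [W.clambdaExt₁_apply hL hX hη (i' := s') rfl (show s' + t = m' by omega)]
    by_cases hdeg : a + s' = 2 * n
    · rw [W.trace_cup_cup_externalCup_of_eq hX hX _ h hdeg (by omega),
        W.trace_cup_cup_externalCup_of_eq hX hX hst h₁ (show a₂ + (s' + 2) = 2 * n by omega)
          (by omega)]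
      congr 1
      have key := W.cupPairing_clambdaOp_left hL hX hη ha (rfl : s' + 2 = s' + 2)
        (show a₂ + (s' + 2) = 2 * n by omega) hdeg x α
      simpa only [cupPairing_apply] using key.symm
    · rw [W.trace_cup_cup_externalCup_of_ne hX hX _ h hdeg,
        W.trace_cup_cup_externalCup_of_ne hX hX hst h₁ (show a₂ + (s' + 2) ≠ 2 * n by omega)]
  · rw [W.clambdaExt₁_eq_zero hL hX hη (by omega) (by omega), map_zero, LinearMap.map_zero₂,
      map_zero]
    by_cases hdeg : a₂ + s = 2 * n
    · have hx : x = 0 := W.eq_zero_of_lt hX (by omega) x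
      rw [hx, map_zero, map_zero, LinearMap.map_zero₂, LinearMap.map_zero₂, map_zero]
    · rw [W.trace_cup_cup_externalCup_of_ne hX hX hst h₁ hdeg]

/-- The pairing against the second summand `α ⊠ (ᶜΛ β)` of `ᶜΛ₁₂ (α ⊠ β)` equals the pairing of
`α ⊠ β` with `y` replaced by `ᶜΛ y`. [folklore] -/
theorem trace_cup_clambdaExt₂ (hL : W.HasHardLefschetz) (hX : IsSmoothProjective n X)
    (hη : W.IsHyperplaneClass X η) {s t m m' a b' b₂ : ℕ} (hst : s + t = m) (hm : m' + 2 = m)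
    (hb : b₂ + 2 = b') (h : a + m' + b' = 2 * (n + n)) (h₂ : a + m + b₂ = 2 * (n + n))
    (x : W.obj X a) (α : W.obj X s) (β : W.obj X t) (y : W.obj X b') :
    W.trace (X ⊗ X) (n + n) (W.cup h (W.cup rfl (W.pullback (fst X X) a x)
        (W.clambdaExt₂ hL hX hη m' s t α β)) (W.pullback (snd X X) b' y)) =
      W.trace (X ⊗ X) (n + n) (W.cup h₂ (W.cup rfl (W.pullback (fst X X) a x)
        (W.externalCup X X hst α β)) (W.pullback (snd X X) b₂ (W.clambdaOp hL hX hη b' b₂ y))) := by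
  by_cases ht : 2 ≤ t
  · obtain ⟨t', rfl⟩ : ∃ t', t = t' + 2 := ⟨t - 2, by omega⟩
    rw [W.clambdaExt₂_apply hL hX hη (j' := t') rfl (show s + t' = m' by omega)]
    by_cases hdeg : a + s = 2 * n
    · rw [W.trace_cup_cup_externalCup_of_eq hX hX _ h hdeg (by omega),
        W.trace_cup_cup_externalCup_of_eq hX hX hst h₂ hdeg (by omega)]
      congr 1
      have key := W.cupPairing_clambdaOp_left hL hX hη (rfl : t' + 2 = t' + 2) hb
        (show t' + b' = 2 * n by omega) (show t' + 2 + b₂ = 2 * n by omega) β y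
      simpa only [cupPairing_apply] using key
    · rw [W.trace_cup_cup_externalCup_of_ne hX hX _ h hdeg,
        W.trace_cup_cup_externalCup_of_ne hX hX hst h₂ hdeg]
  · rw [W.clambdaExt₂_eq_zero hL hX hη (by omega) (by omega), map_zero, LinearMap.map_zero₂,
      map_zero]
    by_cases hdeg : a + s = 2 * n
    · have hy : y = 0 := W.eq_zero_of_lt hX (by omega) y
      rw [hy, map_zero, map_zero, map_zero, map_zero]
    · rw [W.trace_cup_cup_externalCup_of_ne hX hX hst h₂ hdeg]

/-- **Adjunction formula for `ᶜΛ₁₂`** (the computation behind Kleiman 1968, Thm. 2.9: under the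
Künneth–Poincaré dictionary the class `ᶜΛ₁₂ u` induces `ᶜΛ ∘ T + T ∘ ᶜΛ` when `u` induces `T`):
for every `u ∈ Hᵐ(X × X)`, `x ∈ Hᵃ(X)`, `y ∈ Hᵇ'(X)`,
`tr ((pr₁* x ∪ ᶜΛ₁₂ u) ∪ pr₂* y) = tr ((pr₁* (ᶜΛ x) ∪ u) ∪ pr₂* y) + tr ((pr₁* x ∪ u) ∪ pr₂* (ᶜΛ y))`
(Künneth induction on `u`; on `α ⊠ β` it is the symmetry of `ᶜΛ` for the Poincaré pairing). [cite: Kleiman1968AlgebraicCycles, Thm. 2.9] -/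
theorem trace_cup_clambdaKunneth (hL : W.HasHardLefschetz) (hX : IsSmoothProjective n X)
    (hη : W.IsHyperplaneClass X η) {m m' a a₂ b' b₂ : ℕ} (hm : m' + 2 = m) (ha : a₂ + 2 = a)
    (hb : b₂ + 2 = b') (h : a + m' + b' = 2 * (n + n)) (h₁ : a₂ + m + b' = 2 * (n + n))
    (h₂ : a + m + b₂ = 2 * (n + n)) (u : W.obj (X ⊗ X) m) (x : W.obj X a) (y : W.obj X b') :
    W.trace (X ⊗ X) (n + n) (W.cup h (W.cup rfl (W.pullback (fst X X) a x)
        (W.clambdaKunneth hL hX hη m m' u)) (W.pullback (snd X X) b' y)) =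
      W.trace (X ⊗ X) (n + n) (W.cup h₁ (W.cup rfl (W.pullback (fst X X) a₂
          (W.clambdaOp hL hX hη a a₂ x)) u) (W.pullback (snd X X) b' y)) +
        W.trace (X ⊗ X) (n + n) (W.cup h₂ (W.cup rfl (W.pullback (fst X X) a x) u)
          (W.pullback (snd X X) b₂ (W.clambdaOp hL hX hη b' b₂ y))) := by
  induction u using W.kunneth_induction hX hX with
  | zero => simp
  | add u v hu hv =>
    simp only [map_add, LinearMap.add_apply]
    rw [hu, hv]
    abel
  | ext s t hst α β =>
    rw [W.clambdaKunneth_externalCup_eq hL hX hη hst, map_add, LinearMap.map_add₂, map_add,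
      W.trace_cup_clambdaExt₁ hL hX hη hst hm ha h h₁, W.trace_cup_clambdaExt₂ hL hX hη hst hm hb h h₂]

end Kunneth

end WeilCohomology

end Literature.AlgebraicGeometry.Motives

end
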